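import Literature.IUT.HodgeTheaters.TemperedCoveringsProofs
import HarnessLib

/-!
# [IUTchI] Corollary 2.3 (iii), the "in particular" (kurims p. 47), PROOFS — node IUTchI:Cor2.3(iii)

Mochizuki, *Inter-universal Teichmüller theory I: construction of Hodge theaters*, kurims
manuscript (May 2020), §2, Corollary 2.3 (iii) p. 47, proof pp. 48–49 [cite: Mochizuki2012, Cor 2.3(iii) pp.47-49]
(D-0012 claim key; series status DISPUTED — nothing printed is asserted here).  PROOF-ONLY
companion of `Literature.IUT.HodgeTheaters.TemperedCoverings` (seat abc-iut-L5-t1, typed predicate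
`StableCurveTemperedData.Cor23iii`) and of `TemperedCoveringsProofs` (abc-iut-L5-t11:
`piXH_inf_delta_of_cor23i`); abc-iut cell node `IUTchI:Cor2.3(iii)` (D-0067 cone of [IUTchIII]
Cor. 3.12, layer L5).  No new definitions.

WHAT IS KERNEL-CHECKED.  Print, p. 47: "(iii) Suppose that [(a) or (b)].  Then `Δ̂_{X,ℍ}` is slim.
In particular, the natural outer actions of `G_k` on `Δ^tp_{X,ℍ}`, `Δ̂_{X,ℍ}` [cf. (i)] determine
natural exact sequences of center-free topological groups [cf. (ii); the slimness of `Δ̂_{X,ℍ}`;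
[AbsAnab], Theorem 1.1.1, (ii)] `1 → Δ^tp_{X,ℍ} → Π^tp_{X,ℍ} → G_k → 1`,
`1 → Δ̂_{X,ℍ} → Π̂_{X,ℍ} → G_k → 1`."  The DEDUCTION of the "in particular" from exactly the inputs
print brackets is proved here, over ARBITRARY interface data `D : StableCurveTemperedData`:

* `[cf. (i)]` — the outer `G_k`-action on `Δ_X` descends to `Δ_{X,ℍ}`: for every `g ∈ Π_X`,
  `g Δ_{X,ℍ} g⁻¹` is a `Δ_X`-conjugate of `Δ_{X,ℍ}` (hypotheses `hOutTp`, `hOutHat`; this is the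
  un-typed "in particular" of Cor. 2.3 (i), i.e. the `G_k`-stability of `ℍ`, and it is itself
  DERIVED here from the `𝔾`-level stability "`ℍ ⊆ 𝔾` is stabilized by the natural action of `G_k`
  on `𝔾`" (p. 47): `conj_comap_smul_eq_of_equivariant`, `outerTp_of_graphStable`,
  `outerHat_of_graphStable`) ⇒ `Π_{X,ℍ} := N_{Π_X}(Δ_{X,ℍ})` SURJECTS onto `G_k`
  (`surjective_normalizer_of_outer`, `piTpXH_surjective_of_outer`, `piHatXH_surjective_of_outer`);
  with `Π_{X,ℍ} ∩ Δ_X = Δ_{X,ℍ}` (`piXH_inf_delta_of_cor23i`, from the typed Cor. 2.3 (i)) this is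
  the exactness of both sequences;
* `[cf. (ii)]` — `Δ^tp_{X,ℍ}` is dense in `Δ̂_{X,ℍ}` (the typed `Cor23ii`) ⇒ the centre of `Δ^tp_{X,ℍ}`
  maps into the centre of `Δ̂_{X,ℍ}` (`eq_one_of_commute_of_topologicalClosure`,
  `center_deltaTpH_eq_bot`);
* `[the slimness of Δ̂_{X,ℍ}]` — the FIRST sentence of (iii), print's deep input ([Tama2] Thm. 0.2
  (v), [AbsTopII] Prop. 1.3 (iv) / [NodNon] Prop. 3.9 (i), [SemiAnbd] Cor. 3.11, [Config] Prop. 1.4,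
  pp. 48–49), enters BY NAME as the hypothesis `D.Cor23Hyp → IsSlimGroup D.deltaHatH` (= the typed
  field `Cor23iii.slim`; it is NOT proved here) ⇒ `Z(Δ̂_{X,ℍ}) = 1` (`center_eq_bot_of_isSlimGroup`);
* `[[AbsAnab], Theorem 1.1.1, (ii)]` — `G_k` is slim, so centre-free: hypothesis
  `Subgroup.center D.Gk = ⊥` (the interface records `G_k` as a bare group) ⇒ the centres of
  `Π^tp_{X,ℍ}`, `Π̂_{X,ℍ}` are trivial (`center_eq_bot_of_extension`, an extension of a centre-free group
  by a centre-free group along a surjection is centre-free).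

Main result: `StableCurveTemperedData.cor23iii_of_slim`.  Honest status: this settles the
"in particular" of node IUTchI:Cor2.3(iii) modulo its printed inputs; the slimness of `Δ̂_{X,ℍ}`
remains the named (iii)-hypothesis (AFTER-MERGE on layers L3/L4); nothing here bears on or takes a
side on [IUTchIII] Cor. 3.12; typed ≠ discharged.
-/

namespace Literature.IUT.HodgeTheaters

open Pointwise Topology
open Literature.AlgebraicGeometry.Frobenioids (IsSlimGroup)
open Literature.AnabelianGeometry.AbsoluteAnabelian (IsCommensurablyTerminal IsNormallyTerminal)

universe u

/-! ### Abstract group theory: centres, normalisers of conjugacy-stable subgroups, extensions -/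

section Abstract

variable {P : Type*} [Group P] {G : Type*} [Group G] {T : Type*} [Group T]

/-- A slim topological group is centre-free (the definition of slimness, [FrdI] §0 / [AbsAnab]
Def. 0.1 (i), applied to the open subgroup `P ⊆ P`). [cite: Mochizuki2012, Cor 2.3(iii) p.47] -/
theorem center_eq_bot_of_isSlimGroup [TopologicalSpace P] (h : IsSlimGroup P) :
    Subgroup.center P = ⊥ := by
  rw [← Subgroup.centralizer_univ, ← Subgroup.coe_top]
  exact h.centralizer_eq_bot ⊤ isOpen_univ

/-- **Centres of dense subgroups** ("[cf. (ii); the slimness of `Δ̂_{X,ℍ}`]", p. 47): in a Hausdorff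
topological group, if `K` is dense in the subgroup `L` and `L` is centre-free, then an element of `L`
commuting with `K` is trivial (the centraliser of `K` is closed, hence contains `L`).
[cite: Mochizuki2012, Cor 2.3(iii) p.47] -/
theorem eq_one_of_commute_of_topologicalClosure [TopologicalSpace P] [IsTopologicalGroup P]
    [T2Space P] {K L : Subgroup P} (hKL : K.topologicalClosure = L) (hL : Subgroup.center L = ⊥)
    {y : P} (hyL : y ∈ L) (hy : ∀ k ∈ K, k * y = y * k) : y = 1 := by
  have hC : IsClosed {b : P | b * y = y * b} :=
    isClosed_eq (continuous_id.mul continuous_const) (continuous_const.mul continuous_id)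
  have hsub : (L : Set P) ⊆ {b : P | b * y = y * b} := by
    rw [← hKL, Subgroup.topologicalClosure_coe]
    exact closure_minimal (fun k hk => hy k hk) hC
  have hcen : (⟨y, hyL⟩ : L) ∈ Subgroup.center L := by
    rw [Subgroup.mem_center_iff]
    intro g
    exact Subtype.ext (hsub g.2)
  rw [hL, Subgroup.mem_bot] at hcen
  exact congrArg Subtype.val hcen

/-- **`d⁻¹ g` normalises `K` when `g K g⁻¹ = d K d⁻¹`.** [cite: Mochizuki2012, Cor 2.3(iii) p.47] -/
theorem inv_mul_mem_normalizer_of_conj_smul_eq {K : Subgroup P} {g d : P}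
    (h : MulAut.conj g • K = MulAut.conj d • K) :
    d⁻¹ * g ∈ Subgroup.normalizer (K : Set P) := by
  rw [Subgroup.mem_normalizer_iff]
  intro x
  have e : d⁻¹ * g * x * (d⁻¹ * g)⁻¹ = (MulAut.conj d)⁻¹ • (MulAut.conj g • x) := by
    rw [MulAut.smul_def, MulAut.smul_def, MulAut.conj_inv_apply, MulAut.conj_apply, mul_inv_rev,
      inv_inv]
    simp only [mul_assoc]
  rw [e, ← Subgroup.mem_pointwise_smul_iff_inv_smul_mem, ← h, Subgroup.smul_mem_pointwise_smul_iff]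

/-- **Exactness on the right from the descent of the outer action** ("the natural outer actions of
`G_k` … determine natural exact sequences … `→ Π_{X,ℍ} → G_k → 1`", p. 47): let `pr : P ↠ G` be
surjective and `K ⊆ P` a subgroup such that every conjugate `g K g⁻¹`, `g ∈ P`, is already a conjugate
`d K d⁻¹` by an element `d ∈ Ker(pr)`; then `N_P(K) ↠ G`. [cite: Mochizuki2012, Cor 2.3(iii) p.47] -/
theorem surjective_normalizer_of_outer (pr : P →* G) (hpr : Function.Surjective pr) (K : Subgroup P)
    (hOut : ∀ g : P, ∃ d ∈ pr.ker, MulAut.conj g • K = MulAut.conj d • K) :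
    Function.Surjective (pr.comp (Subgroup.normalizer (K : Set P)).subtype) := by
  intro γ
  obtain ⟨g, rfl⟩ := hpr γ
  obtain ⟨d, hd, hK⟩ := hOut g
  refine ⟨⟨d⁻¹ * g, inv_mul_mem_normalizer_of_conj_smul_eq hK⟩, ?_⟩
  rw [MonoidHom.mem_ker] at hd
  simp only [MonoidHom.coe_comp, Subgroup.coe_subtype, Function.comp_apply, map_mul, map_inv, hd,
    inv_one, one_mul]

/-- **Centre-free extensions** ("exact sequences of center-free topological groups", p. 47, from
"the slimness of `Δ̂_{X,ℍ}`" and "[AbsAnab], Theorem 1.1.1, (ii)" [slimness of `G_k`]): let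
`pr : P → G`, `Q ⊆ P` with `Q ↠ G` and `Q ∩ Ker(pr) = M ⊆ Q`; if `M` and `G` are centre-free, so is `Q`.
[cite: Mochizuki2012, Cor 2.3(iii) p.47] -/
theorem center_eq_bot_of_extension (pr : P →* G) (Q : Subgroup P) (M : Subgroup pr.ker)
    (hinf : Q ⊓ pr.ker = M.map pr.ker.subtype) (hMQ : M.map pr.ker.subtype ≤ Q)
    (hsurj : Function.Surjective (pr.comp Q.subtype)) (hM : Subgroup.center M = ⊥)
    (hG : Subgroup.center G = ⊥) : Subgroup.center Q = ⊥ := by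
  rw [eq_bot_iff]
  intro z hz
  rw [Subgroup.mem_center_iff] at hz
  -- the image of `z` in `G` is central, hence trivial
  have h1 : pr (z : P) ∈ Subgroup.center G := by
    rw [Subgroup.mem_center_iff]
    intro γ
    obtain ⟨w, rfl⟩ := hsurj γ
    have e := congrArg (fun q : Q => pr (q : P)) (hz w)
    simpa only [Subgroup.coe_mul, map_mul, MonoidHom.coe_comp, Subgroup.coe_subtype,
      Function.comp_apply] using e
  rw [hG, Subgroup.mem_bot] at h1
  -- so `z ∈ Q ∩ Ker(pr) = M`
  have h2 : (z : P) ∈ M.map pr.ker.subtype := by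
    rw [← hinf]
    exact ⟨z.2, h1⟩
  obtain ⟨m, hm, hmz⟩ := h2
  simp only [Subgroup.coe_subtype] at hmz
  -- `m` is central in `M`
  have h3 : (⟨m, hm⟩ : M) ∈ Subgroup.center M := by
    rw [Subgroup.mem_center_iff]
    intro w
    have hwQ : ((w : pr.ker) : P) ∈ Q := hMQ ⟨w, w.2, rfl⟩
    have e := congrArg Subtype.val (hz ⟨(w : pr.ker), hwQ⟩)
    apply Subtype.ext; apply Subtype.ext
    simp only [Subgroup.coe_mul] at e ⊢
    rw [← hmz] at e
    exact e
  rw [hM, Subgroup.mem_bot] at h3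
  have h4 : (m : P) = 1 := by
    have := congrArg (fun v : M => ((v : pr.ker) : P)) h3
    simpa only [Subgroup.coe_one] using this
  rw [Subgroup.mem_bot]
  apply Subtype.ext
  rw [Subgroup.coe_one, ← hmz, h4]

/-- **Descent of the outer action from `𝔾`-level stability** (p. 47: "the sub-semi-graph `ℍ ⊆ 𝔾` is
stabilized by the natural action of `G_k` on `𝔾`" ⇒ Cor. 2.3 (i) "in particular, the natural outer
actions of `G_k` on `Δ_X` determine natural outer actions of `G_k` on `Δ_{X,ℍ}`"): let `Δ ⊴ P`,
`ρ : Δ ↠ T` a surjection, `H ⊆ T`; if conjugation by `g ∈ P` on `Δ` covers an automorphism `φ` of `T`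
[the action of `g` on `Π_𝔾`] with `φ(H) = t H t⁻¹` for some `t ∈ T` [`ℍ` is stable], then
`g ρ⁻¹(H) g⁻¹ = d ρ⁻¹(H) d⁻¹` for any `d ∈ Δ` over `t`. [cite: Mochizuki2012, Cor 2.3(i) p.47] -/
theorem conj_comap_smul_eq_of_equivariant (Δ : Subgroup P) [hΔ : Δ.Normal] (ρ : Δ →* T)
    (hρ : Function.Surjective ρ) (H : Subgroup T) (g : P) (φ : T ≃* T) (t : T)
    (hφ : ∀ x : Δ, ρ ⟨g * x * g⁻¹, hΔ.conj_mem _ x.2 g⟩ = φ (ρ x))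
    (hφH : H.map φ.toMonoidHom = MulAut.conj t • H) :
    ∃ d : Δ, ρ d = t ∧ MulAut.conj g • ((H.comap ρ).map Δ.subtype) =
      MulAut.conj (d : P) • ((H.comap ρ).map Δ.subtype) := by
  obtain ⟨d, rfl⟩ := hρ t
  refine ⟨d, rfl, ?_⟩
  -- membership in `φ(H) = ρ(d) H ρ(d)⁻¹`, elementwise
  have hmemH : ∀ y : T, φ y ∈ MulAut.conj (ρ d) • H ↔ y ∈ H := by
    intro y
    rw [← hφH]
    constructor
    · rintro ⟨y', hy', he⟩
      rwa [← φ.injective he]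
    · intro hy
      exact ⟨y, hy, rfl⟩
  -- membership in `ρ⁻¹(H) ⊆ P`
  have hmemK : ∀ z : P, z ∈ (H.comap ρ).map Δ.subtype ↔ ∃ hz : z ∈ Δ, ρ ⟨z, hz⟩ ∈ H := by
    intro z
    constructor
    · rintro ⟨w, hw, rfl⟩
      exact ⟨w.2, hw⟩
    · rintro ⟨hz, hw⟩
      exact ⟨⟨z, hz⟩, hw, rfl⟩
  ext y
  rw [Subgroup.mem_pointwise_smul_iff_inv_smul_mem, Subgroup.mem_pointwise_smul_iff_inv_smul_mem,
    MulAut.smul_def, MulAut.smul_def, MulAut.conj_inv_apply, MulAut.conj_inv_apply, hmemK, hmemK]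
  constructor
  · rintro ⟨hy, hyH⟩
    -- `x := g⁻¹ y g ∈ ρ⁻¹(H)`; then `ρ(y) = ρ(g x g⁻¹) = φ(ρ x) ∈ φ(H)`
    have hyΔ : y ∈ Δ := by
      have := hΔ.conj_mem _ hy g
      simpa only [mul_assoc, mul_inv_cancel_left, mul_inv_cancel, mul_one] using this
    have hdy : (d : P)⁻¹ * y * d ∈ Δ := hΔ.conj_mem' _ hyΔ d
    refine ⟨hdy, ?_⟩
    have e1 : ρ ⟨y, hyΔ⟩ = φ (ρ ⟨g⁻¹ * y * g, hy⟩) := by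
      rw [← hφ ⟨g⁻¹ * y * g, hy⟩]
      congr 1
      apply Subtype.ext
      simp only [mul_assoc, mul_inv_cancel_left, mul_inv_cancel, mul_one]
    have e2 : ρ ⟨(d : P)⁻¹ * y * d, hdy⟩ = (ρ d)⁻¹ * ρ ⟨y, hyΔ⟩ * ρ d := by
      rw [← map_inv, ← map_mul, ← map_mul]
      rfl
    rw [e2, e1, ← MulAut.conj_inv_apply, ← MulAut.smul_def,
      ← Subgroup.mem_pointwise_smul_iff_inv_smul_mem, hmemH]
    exact hyH
  · rintro ⟨hy, hyH⟩
    have hyΔ : y ∈ Δ := by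
      have := hΔ.conj_mem _ hy (d : P)
      simpa only [mul_assoc, mul_inv_cancel_left, mul_inv_cancel, mul_one] using this
    have hgy : g⁻¹ * y * g ∈ Δ := hΔ.conj_mem' _ hyΔ g
    refine ⟨hgy, ?_⟩
    have e1 : φ (ρ ⟨g⁻¹ * y * g, hgy⟩) = ρ ⟨y, hyΔ⟩ := by
      rw [← hφ ⟨g⁻¹ * y * g, hgy⟩]
      congr 1
      apply Subtype.ext
      simp only [mul_assoc, mul_inv_cancel_left, mul_inv_cancel, mul_one]
    have e2 : ρ ⟨(d : P)⁻¹ * y * d, hy⟩ = (ρ d)⁻¹ * ρ ⟨y, hyΔ⟩ * ρ d := by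
      rw [← map_inv, ← map_mul, ← map_mul]
      rfl
    rw [← hmemH, e1, Subgroup.mem_pointwise_smul_iff_inv_smul_mem, MulAut.smul_def,
      MulAut.conj_inv_apply, ← e2]
    exact hyH

end Abstract

/-! ### Corollary 2.3 (iii) for the data `D` -/

namespace StableCurveTemperedData

variable (D : StableCurveTemperedData.{u})

/-- `ι_Δ : Δ^tp_X ↪ Δ̂_X` is injective (`Π^tp_X ↪ Π̂_X` is). [cite: Mochizuki2012, Cor 2.3 p.47] -/
theorem ιΔ_injective : Function.Injective D.ιΔ := by
  intro a b h
  have h' := congrArg (fun z : D.DeltaHat => (z : D.PiHat)) h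
  simp only [coe_ιΔ] at h'
  exact Subtype.ext (D.ιX_injective h')

/-- `ι_Δ(Δ^tp_{X,ℍ}) ⊆ Δ̂_{X,ℍ}` (compatibility `ρ̂ ∘ ι_Δ = ι ∘ ρ^tp` of the data and `ι(Π^tp_ℍ) ⊆ Π̂_ℍ`,
p. 44/47). [cite: Mochizuki2012, Cor 2.3(ii) p.47] -/
theorem map_ιΔ_deltaTpH_le : D.deltaTpH.map D.ιΔ ≤ D.deltaHatH := by
  rintro _ ⟨d, hd, rfl⟩
  show D.ρHat (D.ιΔ d) ∈ D.graph.HatH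
  rw [show D.ρHat (D.ιΔ d) = D.graph.ι (D.ρTp d) from (D.ρ_comp d).symm]
  exact D.graph.tpH_le ⟨D.ρTp d, hd, rfl⟩

/-- `Π̂_X ↠ G_k` is surjective (`Π^tp_X ↠ G_k` factors through it). [cite: Mochizuki2012, Cor 2.3 p.47] -/
theorem prHat_surjective : Function.Surjective D.prHat := by
  intro γ
  obtain ⟨t, rfl⟩ := D.prTp_surjective γ
  exact ⟨D.ιX t, D.prHat_ιX t⟩

/-- **Exactness of `Π^tp_{X,ℍ} → G_k → 1`** from the descent of the outer `G_k`-action to `Δ^tp_{X,ℍ}`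
("[cf. (i)]", p. 47): if for every `g ∈ Π^tp_X` the conjugate `g Δ^tp_{X,ℍ} g⁻¹` is a `Δ^tp_X`-conjugate of
`Δ^tp_{X,ℍ}`, then `Π^tp_{X,ℍ} = N_{Π^tp_X}(Δ^tp_{X,ℍ})` surjects onto `G_k`. [cite: Mochizuki2012, Cor 2.3(iii) p.47] -/
theorem piTpXH_surjective_of_outer
    (hOut : ∀ g : D.PiTp, ∃ d : D.DeltaTp, MulAut.conj g • (D.deltaTpH.map D.DeltaTp.subtype) =
      MulAut.conj (d : D.PiTp) • (D.deltaTpH.map D.DeltaTp.subtype)) :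
    Function.Surjective (D.prTp.comp D.piTpXH.subtype) :=
  surjective_normalizer_of_outer D.prTp D.prTp_surjective _ fun g =>
    let ⟨d, hd⟩ := hOut g; ⟨d, d.2, hd⟩

/-- **Exactness of `Π̂_{X,ℍ} → G_k → 1`** from the descent of the outer `G_k`-action to `Δ̂_{X,ℍ}`
("[cf. (i)]", p. 47). [cite: Mochizuki2012, Cor 2.3(iii) p.47] -/
theorem piHatXH_surjective_of_outer
    (hOut : ∀ γ : D.PiHat, ∃ d : D.DeltaHat, MulAut.conj γ • (D.deltaHatH.map D.DeltaHat.subtype) =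
      MulAut.conj (d : D.PiHat) • (D.deltaHatH.map D.DeltaHat.subtype)) :
    Function.Surjective (D.prHat.comp D.piHatXH.subtype) :=
  surjective_normalizer_of_outer D.prHat D.prHat_surjective _ fun γ =>
    let ⟨d, hd⟩ := hOut γ; ⟨d, d.2, hd⟩

/-- **The outer-descent hypothesis (tempered) from `𝔾`-level stability of `ℍ`** (p. 47): if conjugation
by `g ∈ Π^tp_X` on `Δ^tp_X` covers, along `Δ^tp_X ↠ Π^tp_𝔾`, an automorphism `φ` of `Π^tp_𝔾` with
`φ(Π^tp_ℍ)` a `Π^tp_𝔾`-conjugate of `Π^tp_ℍ`, then `g Δ^tp_{X,ℍ} g⁻¹` is a `Δ^tp_X`-conjugate of `Δ^tp_{X,ℍ}`.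
[cite: Mochizuki2012, Cor 2.3(i) p.47] -/
theorem outerTp_of_graphStable (g : D.PiTp) (φ : D.graph.Tp ≃* D.graph.Tp) (t : D.graph.Tp)
    (hφ : ∀ x : D.DeltaTp, D.ρTp ⟨g * x * g⁻¹, D.prTp.normal_ker.conj_mem _ x.2 g⟩ = φ (D.ρTp x))
    (hφH : D.graph.TpH.map φ.toMonoidHom = MulAut.conj t • D.graph.TpH) :
    ∃ d : D.DeltaTp, MulAut.conj g • (D.deltaTpH.map D.DeltaTp.subtype) =
      MulAut.conj (d : D.PiTp) • (D.deltaTpH.map D.DeltaTp.subtype) :=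
  let ⟨d, _, hd⟩ := conj_comap_smul_eq_of_equivariant D.DeltaTp D.ρTp D.ρTp_surjective D.graph.TpH
    g φ t hφ hφH
  ⟨d, hd⟩

/-- **The outer-descent hypothesis (profinite) from `𝔾`-level stability of `ℍ`** (p. 47), for
`Δ̂_X ↠ Π̂_𝔾` and `Π̂_ℍ ⊆ Π̂_𝔾`. [cite: Mochizuki2012, Cor 2.3(i) p.47] -/
theorem outerHat_of_graphStable (γ : D.PiHat) (φ : D.graph.Hat ≃* D.graph.Hat) (t : D.graph.Hat)
    (hφ : ∀ x : D.DeltaHat, D.ρHat ⟨γ * x * γ⁻¹, D.prHat.normal_ker.conj_mem _ x.2 γ⟩ = φ (D.ρHat x))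
    (hφH : D.graph.HatH.map φ.toMonoidHom = MulAut.conj t • D.graph.HatH) :
    ∃ d : D.DeltaHat, MulAut.conj γ • (D.deltaHatH.map D.DeltaHat.subtype) =
      MulAut.conj (d : D.PiHat) • (D.deltaHatH.map D.DeltaHat.subtype) :=
  let ⟨d, _, hd⟩ := conj_comap_smul_eq_of_equivariant D.DeltaHat D.ρHat D.ρHat_surjective
    D.graph.HatH γ φ t hφ hφH
  ⟨d, hd⟩

/-- **`Z(Δ^tp_{X,ℍ}) = 1`** from "(ii)" (density of `Δ^tp_{X,ℍ}` in `Δ̂_{X,ℍ}`, the typed `Cor23ii`) and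
"the slimness of `Δ̂_{X,ℍ}`" (p. 47), `Π̂_X` being Hausdorff [profinite].
[cite: Mochizuki2012, Cor 2.3(iii) p.47] -/
theorem center_deltaTpH_eq_bot [T2Space D.PiHat] (hii : D.Cor23ii)
    (hslim : IsSlimGroup D.deltaHatH) : Subgroup.center D.deltaTpH = ⊥ := by
  rw [eq_bot_iff]
  intro z hz
  rw [Subgroup.mem_center_iff] at hz
  have hyL : D.ιΔ (z : D.DeltaTp) ∈ D.deltaHatH := D.map_ιΔ_deltaTpH_le ⟨z, z.2, rfl⟩
  have hy : ∀ k ∈ D.deltaTpH.map D.ιΔ, k * D.ιΔ (z : D.DeltaTp) = D.ιΔ (z : D.DeltaTp) * k := by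
    rintro _ ⟨w, hw, rfl⟩
    rw [← map_mul, ← map_mul]
    exact congrArg (fun v : D.deltaTpH => D.ιΔ (v : D.DeltaTp)) (hz ⟨w, hw⟩)
  have h1 := eq_one_of_commute_of_topologicalClosure hii.closure_eq
    (center_eq_bot_of_isSlimGroup hslim) hyL hy
  rw [← map_one D.ιΔ] at h1
  rw [Subgroup.mem_bot]
  exact Subtype.ext (D.ιΔ_injective h1)

/-- **Corollary 2.3 (iii), the "in particular", from its printed inputs.**  Over the data `D`:
assume the typed Cor. 2.3 (i) (`hi`) and (ii) (`hii`); the slimness of `Δ̂_{X,ℍ}` under hypothesis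
(a)/(b) — the first sentence of (iii), print's deep input via [Tama2] Thm. 0.2 (v), [AbsTopII]
Prop. 1.3 (iv) / [NodNon] Prop. 3.9 (i), [Config] Prop. 1.4 (pp. 48–49), taken BY NAME (`hslim`, =
the typed field `Cor23iii.slim`); "[AbsAnab], Theorem 1.1.1, (ii)" — `G_k` is slim, hence
centre-free (`hGk`); and the "in particular" of (i) — the outer `G_k`-actions descend to
`Δ^tp_{X,ℍ}`, `Δ̂_{X,ℍ}` (`hOutTp`, `hOutHat`; cf. `outerTp_of_graphStable`).  Then the typed `Cor23iii`
holds: `Δ̂_{X,ℍ}` slim; `1 → Δ_{X,ℍ} → Π_{X,ℍ} → G_k → 1` exact (tempered and profinite); all four groups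
centre-free. [cite: Mochizuki2012, Cor 2.3(iii) p.47] -/
theorem cor23iii_of_slim [T2Space D.PiHat] (hi : D.Cor23i) (hii : D.Cor23ii)
    (hslim : D.Cor23Hyp → IsSlimGroup D.deltaHatH) (hGk : Subgroup.center D.Gk = ⊥)
    (hOutTp : ∀ g : D.PiTp, ∃ d : D.DeltaTp, MulAut.conj g • (D.deltaTpH.map D.DeltaTp.subtype) =
      MulAut.conj (d : D.PiTp) • (D.deltaTpH.map D.DeltaTp.subtype))
    (hOutHat : ∀ γ : D.PiHat, ∃ d : D.DeltaHat,
      MulAut.conj γ • (D.deltaHatH.map D.DeltaHat.subtype) =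
        MulAut.conj (d : D.PiHat) • (D.deltaHatH.map D.DeltaHat.subtype)) :
    D.Cor23iii where
  slim := hslim
  exact_tp _ := ⟨(D.piXH_inf_delta_of_cor23i hi).1, D.piTpXH_surjective_of_outer hOutTp⟩
  exact_hat _ := ⟨(D.piXH_inf_delta_of_cor23i hi).2, D.piHatXH_surjective_of_outer hOutHat⟩
  center_eq_bot hyp := by
    have hΔhat : Subgroup.center D.deltaHatH = ⊥ := center_eq_bot_of_isSlimGroup (hslim hyp)
    have hΔtp : Subgroup.center D.deltaTpH = ⊥ := D.center_deltaTpH_eq_bot hii (hslim hyp)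
    refine ⟨hΔtp, ?_, hΔhat, ?_⟩
    · exact center_eq_bot_of_extension D.prTp D.piTpXH D.deltaTpH
        (D.piXH_inf_delta_of_cor23i hi).1 Subgroup.le_normalizer
        (D.piTpXH_surjective_of_outer hOutTp) hΔtp hGk
    · exact center_eq_bot_of_extension D.prHat D.piHatXH D.deltaHatH
        (D.piXH_inf_delta_of_cor23i hi).2 Subgroup.le_normalizer
        (D.piHatXH_surjective_of_outer hOutHat) hΔhat hGk

/-- **Corollary 2.3 (iii) and (iv) together** (proof, p. 49: "In light of the exact sequences of
assertion (iii), assertion (iv) follows immediately from assertion (i)"): under the hypotheses of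
`cor23iii_of_slim`, the typed `Cor23iv` holds as well (`cor23iv_of_cor23i`).
[cite: Mochizuki2012, Cor 2.3(iv) p.49] -/
theorem cor23iv_of_slim [T2Space D.PiHat] (hi : D.Cor23i) (hii : D.Cor23ii)
    (hslim : D.Cor23Hyp → IsSlimGroup D.deltaHatH) (hGk : Subgroup.center D.Gk = ⊥)
    (hOutTp : ∀ g : D.PiTp, ∃ d : D.DeltaTp, MulAut.conj g • (D.deltaTpH.map D.DeltaTp.subtype) =
      MulAut.conj (d : D.PiTp) • (D.deltaTpH.map D.DeltaTp.subtype))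
    (hOutHat : ∀ γ : D.PiHat, ∃ d : D.DeltaHat,
      MulAut.conj γ • (D.deltaHatH.map D.DeltaHat.subtype) =
        MulAut.conj (d : D.PiHat) • (D.deltaHatH.map D.DeltaHat.subtype)) :
    D.Cor23iv :=
  D.cor23iv_of_cor23i hi (D.cor23iii_of_slim hi hii hslim hGk hOutTp hOutHat)

end StableCurveTemperedData

end Literature.IUT.HodgeTheaters
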